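import Summits.CriticalPhenomena.PercolationContinuityZ3.Theorems.PercNearOneGluingNoHeavyLowerTailSahiCombTriWPairLocal

/-!
# The pair-local principle with MONOTONE TYPE LITERALS, and the typed conjecture `PairLocalKleitman` (⟹ `TriWIneq`)

Support file of the one-cut programme (crux `NoHeavyLowerTail`, stmt-CriticalPhenomena-4575; cell `prim-masterthm`, seat P5 gen 23;
memo `FROM-prim-masterthm-p5-g23-PAIR-LOCAL.md` §3–§5).  Continuation of `…SahiCombTriWPairLocal` (the principle with POINT weights `κ(u,e)`,
i.e. Kleitman gaps between single index profiles `α_u = {x | u ∈ F x}`, `β_e`).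

At `n = 4` point weights do NOT suffice: for `P = K₂₂ = (x₀∨x₁)(x₂∨x₃)` there is no `κ ≥ 0` with `PairLocalCert P c κ` (an explicit 4-row LP
obstruction, kit j163935), but there IS a certificate whose atoms are Kleitman gaps between an index profile and the JOIN of two profiles
(`{x | u ∈ F x ∨ u' ∈ F x}`; kit j164394, verified exactly on all `168⁴` rows, j164849).  The right generality: a TYPE LITERAL is a monotone Boolean
statistic `V(F x, G x)` of the point type `(F x, G x)` (`FiveUpSet.TypeLit`); for monotone families `x ↦ V(F x, G x)` cuts out an up-set of the index
cube, so `Σ_x (V(x) − V(xᶜ))·(B(x) − B(xᶜ))` is again twice a Kleitman gap (`sum_litDiff_mul`, `sum_litDiff_mul_nonneg`).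

* `FiveUpSet.TypeLit`, `litInd`, `litSet` — monotone type literals, their indicator and index-cube trace (an up-set: `isUpperSet_litSet`);
* `FiveUpSet.PairLocalCertLit P c k lam V B` — the literal certificate property: for ALL up-sets `F, F', G, G'` of `W`,
  `Σ_j lam j · (V_j(F,G) − V_j(F',G')) · (B_j(F,G) − B_j(F',G')) ≤ c · triWOne P F F' G G'`;
* **`FiveUpSet.triW_nonneg_of_pairLocalCertLit`** — such a certificate (with `c > 0`) gives `0 ≤ triW P F G` for EVERY index cube;
* **`FiveUpSet.PairLocalKleitman`** (`@[conjecture]`, an obligation of our theory, never a fact) — every up-set `P` of every finite cube has a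
  literal certificate.  EVIDENCE (exact LPs, integer verification on all rows): true for every up-set of `2^n`, `n ≤ 4` (`n ≤ 3` with single-profile
  literals — `…TriWFibreThree`; `n = 4`: 23 of 24 `S₄`-classes with single profiles, `K₂₂` with pairwise joins; kit j163638/j164394/j164849);
* **`FiveUpSet.triWIneq_of_pairLocalKleitman : PairLocalKleitman → TriWIneq`** — the new typed route to the lane's target: a ONE-CUBE statement
  about five up-sets `P, F, F', G, G'` of the SAME cube (no index cube, no nestedness) implies `TRI_W(a) ≥ 0` for every `a`.
HONEST LABEL: the principle and the reduction are proved (std axioms); `PairLocalKleitman` is a typed CONJECTURE (finite per `n`, verified `n ≤ 4`);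
`TriWIneq` stays OPEN. [this work]
-/

namespace Summit.CriticalPhenomena.PercolationContinuityZ3.Theorems

namespace FiveUpSet

open Finset

variable {β γ : Type} [DecidableEq β] [Fintype β] [DecidableEq γ] [Fintype γ]

/-! ### Monotone type literals -/

/-- A MONOTONE TYPE LITERAL: a Boolean statistic of a point type `(F x, G x)` (two families of subsets), monotone under enlarging either family.
Examples: `[u ∈ F]`, `[u ∈ F ∨ u' ∈ F]`, `[u ∈ F ∧ e ∈ G]`. [this work] -/
structure TypeLit (γ : Type) [DecidableEq γ] where
  /-- the statistic -/
  val : Finset (Finset γ) → Finset (Finset γ) → Bool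
  /-- monotonicity in both families -/
  mono : ∀ F F' G G' : Finset (Finset γ), F ⊆ F' → G ⊆ G' → val F G = true → val F' G' = true

/-- The `0/1` indicator of a type literal at a type. [this work] -/
def litInd (V : TypeLit γ) (F G : Finset (Finset γ)) : ℤ := if V.val F G = true then 1 else 0

/-- The index-cube trace of a type literal along two families: `{x | V(F x, G x)}`. [this work] -/
def litSet (V : TypeLit γ) (F G : Finset β → Finset (Finset γ)) : Finset (Finset β) :=
  univ.filter fun x => V.val (F x) (G x) = true

omit [DecidableEq β] [Fintype γ] in
/-- Membership in the trace. [this work] -/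
@[simp] theorem mem_litSet (V : TypeLit γ) (F G : Finset β → Finset (Finset γ)) (x : Finset β) :
    x ∈ litSet V F G ↔ V.val (F x) (G x) = true := by
  simp [litSet]

omit [DecidableEq β] [Fintype γ] in
/-- For monotone families the trace of a monotone literal is an up-set of the index cube. [this work] -/
theorem isUpperSet_litSet (V : TypeLit γ) {F G : Finset β → Finset (Finset γ)} (hFm : Monotone F) (hGm : Monotone G) :
    IsUpperSet (litSet V F G : Set (Finset β)) := by
  intro x y hxy hx
  rw [mem_coe, mem_litSet] at hx ⊢
  exact V.mono _ _ _ _ (hFm hxy) (hGm hxy) hx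

/-! ### The key identity for literals -/

omit [Fintype γ] in
/-- `Σ_x [p x][q x] = #(S_p ∩ S_q)` for Boolean predicates on the index cube. [this work] -/
theorem sum_boolInd_mul (p q : Finset β → Bool) :
    ∑ x : Finset β, (if p x = true then (1 : ℤ) else 0) * (if q x = true then (1 : ℤ) else 0)
      = (((univ.filter fun x => p x = true) ∩ (univ.filter fun x => q x = true)).card : ℤ) := by
  have h : ∀ x : Finset β, (if p x = true then (1 : ℤ) else 0) * (if q x = true then (1 : ℤ) else 0)
      = if x ∈ (univ.filter fun x => p x = true) ∩ (univ.filter fun x => q x = true) then (1 : ℤ) else 0 := by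
    intro x
    by_cases h1 : p x = true <;> by_cases h2 : q x = true <;> simp [h1, h2]
  rw [Finset.sum_congr rfl (fun x _ => h x), Finset.sum_boole, Finset.filter_univ_mem]

omit [Fintype γ] in
/-- `Σ_x [p x][q xᶜ] = #(S_p ∩ refl S_q)`. [this work] -/
theorem sum_boolInd_mul_compl (p q : Finset β → Bool) :
    ∑ x : Finset β, (if p x = true then (1 : ℤ) else 0) * (if q xᶜ = true then (1 : ℤ) else 0)
      = (((univ.filter fun x => p x = true) ∩ refl (univ.filter fun x => q x = true)).card : ℤ) := by
  have h : ∀ x : Finset β, (if p x = true then (1 : ℤ) else 0) * (if q xᶜ = true then (1 : ℤ) else 0)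
      = if x ∈ (univ.filter fun x => p x = true) ∩ refl (univ.filter fun x => q x = true) then (1 : ℤ) else 0 := by
    intro x
    by_cases h1 : p x = true <;> by_cases h2 : q xᶜ = true <;> simp [h1, h2, mem_refl]
  rw [Finset.sum_congr rfl (fun x _ => h x), Finset.sum_boole, Finset.filter_univ_mem]

omit [Fintype γ] in
/-- `Σ_x [p xᶜ][q x] = #(S_p ∩ refl S_q)` (re-index by the antipode). [this work] -/
theorem sum_boolInd_compl_mul (p q : Finset β → Bool) :
    ∑ x : Finset β, (if p xᶜ = true then (1 : ℤ) else 0) * (if q x = true then (1 : ℤ) else 0)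
      = (((univ.filter fun x => p x = true) ∩ refl (univ.filter fun x => q x = true)).card : ℤ) := by
  rw [← sum_boolInd_mul_compl p q]
  refine Fintype.sum_equiv (complEquiv β) _ _ fun x => ?_
  show (if p xᶜ = true then (1 : ℤ) else 0) * (if q x = true then (1 : ℤ) else 0)
      = (if p xᶜ = true then (1 : ℤ) else 0) * (if q xᶜᶜ = true then (1 : ℤ) else 0)
  rw [compl_compl]

omit [Fintype γ] in
/-- `Σ_x [p xᶜ][q xᶜ] = #(S_p ∩ S_q)`. [this work] -/
theorem sum_boolInd_compl_mul_compl (p q : Finset β → Bool) :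
    ∑ x : Finset β, (if p xᶜ = true then (1 : ℤ) else 0) * (if q xᶜ = true then (1 : ℤ) else 0)
      = (((univ.filter fun x => p x = true) ∩ (univ.filter fun x => q x = true)).card : ℤ) := by
  rw [← sum_boolInd_mul p q]
  exact Fintype.sum_equiv (complEquiv β)
    (fun x => (if p xᶜ = true then (1 : ℤ) else 0) * (if q xᶜ = true then (1 : ℤ) else 0))
    (fun x => (if p x = true then (1 : ℤ) else 0) * (if q x = true then (1 : ℤ) else 0)) fun x => rfl

omit [Fintype γ] in
/-- **Key identity for literals.**  `Σ_x (V(x) − V(xᶜ))·(B(x) − B(xᶜ)) = 2·(#(S_V ∩ S_B) − #(S_V ∩ refl S_B))`, `S_V = litSet V F G`. [this work] -/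
theorem sum_litDiff_mul (V B : TypeLit γ) (F G : Finset β → Finset (Finset γ)) :
    ∑ x : Finset β, (litInd V (F x) (G x) - litInd V (F xᶜ) (G xᶜ)) * (litInd B (F x) (G x) - litInd B (F xᶜ) (G xᶜ))
      = 2 * (((litSet V F G ∩ litSet B F G).card : ℤ) - (litSet V F G ∩ refl (litSet B F G)).card) := by
  set p : Finset β → Bool := fun x => V.val (F x) (G x) with hp
  set q : Finset β → Bool := fun x => B.val (F x) (G x) with hq
  have hx : ∀ x : Finset β, (litInd V (F x) (G x) - litInd V (F xᶜ) (G xᶜ)) * (litInd B (F x) (G x) - litInd B (F xᶜ) (G xᶜ))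
      = (((if p x = true then (1 : ℤ) else 0) * (if q x = true then (1 : ℤ) else 0)
        - (if p x = true then (1 : ℤ) else 0) * (if q xᶜ = true then (1 : ℤ) else 0))
        - (if p xᶜ = true then (1 : ℤ) else 0) * (if q x = true then (1 : ℤ) else 0))
        + (if p xᶜ = true then (1 : ℤ) else 0) * (if q xᶜ = true then (1 : ℤ) else 0) := by
    intro x; unfold litInd; ring
  have hSV : litSet V F G = univ.filter fun x => p x = true := rfl
  have hSB : litSet B F G = univ.filter fun x => q x = true := rfl
  rw [Finset.sum_congr rfl (fun x _ => hx x), sum_add_distrib, sum_sub_distrib, sum_sub_distrib,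
    sum_boolInd_mul p q, sum_boolInd_mul_compl p q, sum_boolInd_compl_mul p q, sum_boolInd_compl_mul_compl p q, hSV, hSB]
  ring

omit [Fintype γ] in
/-- The index-cube average of a literal pair product is non-negative for MONOTONE families (Kleitman in the index cube). [this work] -/
theorem sum_litDiff_mul_nonneg (V B : TypeLit γ) {F G : Finset β → Finset (Finset γ)} (hFm : Monotone F) (hGm : Monotone G) :
    0 ≤ ∑ x : Finset β, (litInd V (F x) (G x) - litInd V (F xᶜ) (G xᶜ)) * (litInd B (F x) (G x) - litInd B (F xᶜ) (G xᶜ)) := by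
  rw [sum_litDiff_mul]
  have h := card_inter_refl_le (isUpperSet_litSet V hFm hGm) (isUpperSet_litSet B hFm hGm)
  omega

/-! ### Literal certificates and the principle -/

/-- **The literal pair-local certificate property.**  `k` atoms with weights `lam j` and literal pairs `(V j, B j)`: for ALL up-sets `F, F', G, G'`
of `W`, `Σ_j lam j · (V_j(F,G) − V_j(F',G')) · (B_j(F,G) − B_j(F',G')) ≤ c · triWOne P F F' G G'`. [this work] -/
def PairLocalCertLit (P : Finset (Finset γ)) (c k : ℕ) (lam : Fin k → ℕ) (V B : Fin k → TypeLit γ) : Prop :=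
  ∀ F F' G G' : Finset (Finset γ),
    IsUpperSet (F : Set (Finset γ)) → IsUpperSet (F' : Set (Finset γ)) →
    IsUpperSet (G : Set (Finset γ)) → IsUpperSet (G' : Set (Finset γ)) →
      ∑ j : Fin k, (lam j : ℤ) * (litInd (V j) F G - litInd (V j) F' G') * (litInd (B j) F G - litInd (B j) F' G')
        ≤ (c : ℤ) * LatticeFiveUpSet.triWOne (complEquiv γ) P F F' G G'

/-- **The pair-local principle, literal form.**  A literal certificate for `P` with `c > 0` gives `0 ≤ triW P F G` for EVERY index cube and all
monotone families of up-sets. [this work] -/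
theorem triW_nonneg_of_pairLocalCertLit {P : Finset (Finset γ)} {c k : ℕ} {lam : Fin k → ℕ} {V B : Fin k → TypeLit γ}
    (hc : 0 < c) (hcert : PairLocalCertLit P c k lam V B) (F G : Finset β → Finset (Finset γ))
    (hF : ∀ x, IsUpperSet (F x : Set (Finset γ))) (hG : ∀ x, IsUpperSet (G x : Set (Finset γ)))
    (hFm : Monotone F) (hGm : Monotone G) :
    0 ≤ triW P F G := by
  have hsum : ∑ x : Finset β, ∑ j : Fin k, (lam j : ℤ) * (litInd (V j) (F x) (G x) - litInd (V j) (F xᶜ) (G xᶜ))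
        * (litInd (B j) (F x) (G x) - litInd (B j) (F xᶜ) (G xᶜ))
      ≤ ∑ x : Finset β, (c : ℤ) * LatticeFiveUpSet.triWOne (complEquiv γ) P (F x) (F xᶜ) (G x) (G xᶜ) :=
    sum_le_sum fun x _ => hcert (F x) (F xᶜ) (G x) (G xᶜ) (hF x) (hF xᶜ) (hG x) (hG xᶜ)
  have hR : ∑ x : Finset β, (c : ℤ) * LatticeFiveUpSet.triWOne (complEquiv γ) P (F x) (F xᶜ) (G x) (G xᶜ)
      = (c : ℤ) * (2 * triW P F G) := by
    rw [two_mul_triW, mul_sum]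
  have hL : 0 ≤ ∑ x : Finset β, ∑ j : Fin k, (lam j : ℤ) * (litInd (V j) (F x) (G x) - litInd (V j) (F xᶜ) (G xᶜ))
        * (litInd (B j) (F x) (G x) - litInd (B j) (F xᶜ) (G xᶜ)) := by
    rw [sum_comm]
    refine sum_nonneg fun j _ => ?_
    have hk : ∑ x : Finset β, (lam j : ℤ) * (litInd (V j) (F x) (G x) - litInd (V j) (F xᶜ) (G xᶜ))
          * (litInd (B j) (F x) (G x) - litInd (B j) (F xᶜ) (G xᶜ))
        = (lam j : ℤ) * ∑ x : Finset β, (litInd (V j) (F x) (G x) - litInd (V j) (F xᶜ) (G xᶜ))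
          * (litInd (B j) (F x) (G x) - litInd (B j) (F xᶜ) (G xᶜ)) := by
      rw [mul_sum]
      refine sum_congr rfl fun x _ => ?_
      ring
    rw [hk]
    exact mul_nonneg (by exact_mod_cast Nat.zero_le _) (sum_litDiff_mul_nonneg (V j) (B j) hFm hGm)
  have h2 : 0 ≤ (c : ℤ) * (2 * triW P F G) := by rw [← hR]; exact hL.trans hsum
  have hc' : (0 : ℤ) < c := by exact_mod_cast hc
  nlinarith

/-! ### The typed conjecture and the reduction of `TriWIneq` -/

/-- **`PairLocalKleitman`** (CONJECTURE — an obligation of our theory, never a fact; memo §5).  Every up-set `P` of every finite cube `Finset γ` admits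
a LITERAL PAIR-LOCAL CERTIFICATE: `c > 0` and finitely many Kleitman-type atoms (monotone type literals `V_j, B_j` with weights `lam_j`) such that
`c · triWOne P F F' G G' ≥ Σ_j lam_j (V_j(F,G) − V_j(F',G'))(B_j(F,G) − B_j(F',G'))` for ALL up-sets `F, F', G, G'` of the cube — a finite statement
for each cube dimension `n`, about five up-sets of ONE cube.  EVIDENCE: exact LP certificates with integer weights, verified in exact arithmetic on all
`#Up(2^n)⁴` rows, for EVERY up-set of `2^n`, `n ≤ 4` (n ≤ 3: single-profile literals `[u ∈ F]`, `[e ∈ G]`, in Lean for `n = 3`; n = 4: the same for 23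
of the 24 `S₄`-classes and profile-JOIN literals for `K₂₂`; kit j163969, j163638, j164394, j164849).  OPEN in general. [this work] -/
@[conjecture] def PairLocalKleitman : Prop :=
  ∀ (γ : Type) [DecidableEq γ] [Fintype γ] (P : Finset (Finset γ)), IsUpperSet (P : Set (Finset γ)) →
    ∃ (c k : ℕ) (lam : Fin k → ℕ) (V B : Fin k → TypeLit γ), 0 < c ∧ PairLocalCertLit P c k lam V B

/-- **`PairLocalKleitman → TriWIneq`**: the one-cube conjecture implies `TRI_W(a) ≥ 0` for every `a` (pair-local principle, literal form). [this work] -/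
theorem triWIneq_of_pairLocalKleitman (h : PairLocalKleitman) : TriWIneq := by
  intro β γ _ _ _ _ P F G hP hF hG hFm hGm
  obtain ⟨c, k, lam, V, B, hc, hcert⟩ := h γ P hP
  exact triW_nonneg_of_pairLocalCertLit hc hcert F G hF hG hFm hGm

end FiveUpSet

end Summit.CriticalPhenomena.PercolationContinuityZ3.Theorems
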